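import Literature.MathematicalPhysics.QuantumFieldTheory.Balaban1983to89.BlockAveragingSectionPlaq
import HarnessLib

/-!
# `Balaban1983to89.BlockAveragingSectionAction` — the Wilson action of the face section: `A(faceSec V) = L^{d−2} · A(V)`

Cell `ym3-torus` (HUMAN RULING D-0037, YM ladder rung R3), seat `ym3-torus-p1` gen 4; sequel of `BlockAveragingSection` (p411383) and
`BlockAveragingSectionPlaq`.  By `plaqHol_faceSec` the section `faceSec V` of Bałaban's (0.4) averaging carries the plaquette variable
`V(∂Q)` on every EDGE plaquette over `Q` and `1` elsewhere; here the edge plaquettes over each coarse plaquette are COUNTED — exactly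
`L^{d−2}` (the base point runs over the block sites with the two plaquette coordinates at the last position: `edgeFiberEquiv`,
`card_fun_two_fixed`, `card_filter_edge`) — whence **`wilsonAction4_faceSec`**: `A(faceSec V) = L^{d−2}·A(V)`.  Consequence (d = 3,
`T3SectionAction`): the one-step constrained minimum of `T3ConstrainedMinimiser` obeys `minAction_{K,K+1}(W) ≤ L·A(W)` — the a-priori
form, with constant `L^{d−1}` in place of `1 + o(1)`, of the cell's INTERP node.  Elementary counting; no estimate.
-/

noncomputable section

namespace Literature.MathematicalPhysics.QuantumFieldTheory.Balaban1983to89.BlockAveragingSectionAction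

open T4Continuum AveragingRT BlockAveraging BlockAveragingSection BlockAveragingSectionPlaq

variable {P : Params} {j : ℕ} {G : Type*} [GaugeGroup G]

/-! ## The action of the section: `A(faceSec V) = L^{d−2} · A(V)` -/

section Action

open scoped Classical

/-- The offsets of a site, as a block parameter `Fin d → Fin L`. [cite: Balaban1987RG1, (0.3) p.252] -/
def offsets (x : Site P j) : Fin P.d → Fin P.L := fun ν => ⟨offset x ν, offset_lt x ν⟩

/-- A site is the block site of its own block with its own offsets (standing range; `Site.blockEquiv`). [cite: Balaban1987RG1, (0.3) p.252] -/
theorem blockSite_blockOf_offsets (hj : j + 1 ≤ P.m + P.K) (x : Site P j) : Site.blockSite (blockOf x) (offsets x) = x :=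
  congrArg Subtype.val ((Site.blockEquiv hj (blockOf x)).left_inv ⟨x, rfl⟩)

/-- The coarse plaquette `⟨blockOf x, μ, ν⟩` under the fine plaquette `⟨x, μ, ν⟩`. [cite: Balaban1985Averaging, (5) p.18] -/
def coarsePlaq (p : Plaq P j) : Plaq P (j+1) := ⟨blockOf p.src, p.μ, p.ν, p.hμν⟩

/-- EDGE plaquettes of the block decomposition: base point at the last position of its block in both directions of the plaquette.
[cite: Balaban1987RG1, (0.3) p.252] -/
def IsEdge (p : Plaq P j) : Prop := offset p.src p.μ = P.L - 1 ∧ offset p.src p.ν = P.L - 1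

/-- The edge plaquettes over a coarse plaquette `Q` ≃ the block parameters with the two plaquette coordinates fixed to `L − 1`.
[cite: Balaban1987RG1, (0.3) p.252] -/
def edgeFiberEquiv (hj : j + 1 ≤ P.m + P.K) (Q : Plaq P (j+1)) :
    {p : Plaq P j // coarsePlaq p = Q ∧ IsEdge p} ≃
      {r : Fin P.d → Fin P.L // r Q.μ = ⟨P.L - 1, by have := P.hL.2; omega⟩ ∧ r Q.ν = ⟨P.L - 1, by have := P.hL.2; omega⟩} where
  toFun p := ⟨offsets p.1.src, by
    obtain ⟨hQ, h1, h2⟩ := p.2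
    have hμ : p.1.μ = Q.μ := congrArg Plaq.μ hQ
    have hν : p.1.ν = Q.ν := congrArg Plaq.ν hQ
    exact ⟨Fin.ext (by rw [← hμ]; exact h1), Fin.ext (by rw [← hν]; exact h2)⟩⟩
  invFun r := ⟨⟨Site.blockSite Q.src r.1, Q.μ, Q.ν, Q.hμν⟩, by
    obtain ⟨h1, h2⟩ := r.2
    refine ⟨?_, ?_, ?_⟩
    · show (⟨blockOf (Site.blockSite Q.src r.1), Q.μ, Q.ν, Q.hμν⟩ : Plaq P (j+1)) = Q
      rw [Site.blockOf_blockSite hj]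
    · show offset (Site.blockSite Q.src r.1) Q.μ = P.L - 1
      rw [offset_blockSite hj, h1]
    · show offset (Site.blockSite Q.src r.1) Q.ν = P.L - 1
      rw [offset_blockSite hj, h2]⟩
  left_inv p := by
    obtain ⟨p, hQ, h1, h2⟩ := p
    apply Subtype.ext
    have hsrc : blockOf p.src = Q.src := congrArg Plaq.src hQ
    have hμ : p.μ = Q.μ := congrArg Plaq.μ hQ
    have hν : p.ν = Q.ν := congrArg Plaq.ν hQ
    show (⟨Site.blockSite Q.src (offsets p.src), Q.μ, Q.ν, Q.hμν⟩ : Plaq P j) = p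
    cases p with
    | mk src μ ν hμν =>
      simp only at hsrc hμ hν ⊢
      subst hμ hν
      rw [← hsrc, blockSite_blockOf_offsets hj]
  right_inv r := by
    apply Subtype.ext
    funext ν
    exact Fin.ext (offset_blockSite hj Q.src r.1 ν)

/-- Functions `Fin d → Fin L` with two distinct coordinates prescribed number `L^{d−2}`. [cite: Balaban1987RG1, (0.3) p.252] -/
theorem card_fun_two_fixed {d L : ℕ} {μ ν : Fin d} (hμν : μ ≠ ν) (a b : Fin L) :
    Fintype.card {r : Fin d → Fin L // r μ = a ∧ r ν = b} = L ^ (d - 2) := by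
  let S : Finset (Fin d) := {μ, ν}
  have hS : S.card = 2 := Finset.card_pair hμν
  let e : {r : Fin d → Fin L // r μ = a ∧ r ν = b} ≃ ({κ : Fin d // κ ∉ S} → Fin L) :=
    { toFun := fun r κ => r.1 κ.1
      invFun := fun f => ⟨fun κ => if h : κ ∈ S then (if κ = μ then a else b) else f ⟨κ, h⟩, by
        constructor
        · simp [S]
        · simp [S, hμν.symm]⟩
      left_inv := by
        rintro ⟨r, hrμ, hrν⟩
        apply Subtype.ext
        funext κ
        simp only
        split_ifs with h hκ
        · rw [hκ, hrμ]
        · have : κ = ν := by simpa [S, hκ] using h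
          rw [this, hrν]
        · rfl
      right_inv := by
        intro f
        funext κ
        have hκ : κ.1 ∉ S := κ.2
        simp only [dif_neg hκ] }
  rw [Fintype.card_congr e, Fintype.card_fun, Fintype.card_fin]
  congr 1
  rw [Fintype.card_subtype_compl, Fintype.card_fin]
  simp only [Fintype.card_coe, hS]

/-- **EXACTLY `L^{d−2}` EDGE PLAQUETTES LIE OVER EACH COARSE PLAQUETTE** (standing range). [cite: Balaban1987RG1, (0.3) p.252] -/
theorem card_filter_edge (hj : j + 1 ≤ P.m + P.K) (Q : Plaq P (j+1)) :
    (Finset.univ.filter fun p : Plaq P j => coarsePlaq p = Q ∧ IsEdge p).card = P.L ^ (P.d - 2) := by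
  rw [← Fintype.card_subtype, Fintype.card_congr (edgeFiberEquiv hj Q)]
  exact card_fun_two_fixed (ne_of_lt Q.hμν) _ _

/-- **THE WILSON ACTION OF THE SECTION IS `L^{d−2}` TIMES THE COARSE ACTION**: `A(faceSec V) = L^{d−2}·A(V)` — each coarse plaquette
variable is reproduced on the `L^{d−2}` edge plaquettes over it and all other fine plaquettes are trivial (standing range). [cite: Balaban1987RG1, (0.2)/(0.4) p.252] -/
theorem wilsonAction4_faceSec (hj : j + 1 ≤ P.m + P.K) (V : GaugeField P (j+1) G) :
    wilsonAction4 (faceSec V) = ((P.L : ℝ)) ^ (P.d - 2) * wilsonAction4 V := by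
  unfold wilsonAction4 wilsonAction
  rw [← Finset.sum_fiberwise_of_maps_to (g := coarsePlaq) (t := Finset.univ) (fun p _ => Finset.mem_univ _), Finset.mul_sum]
  refine Finset.sum_congr rfl fun Q _ => ?_
  have hterm : ∀ p ∈ Finset.univ.filter (fun p : Plaq P j => coarsePlaq p = Q),
      (1 : ℝ) * (1 - reTr (GaugeField.plaqHol (faceSec V) p)) =
        if IsEdge p then 1 * (1 - reTr (GaugeField.plaqHol V Q)) else 0 := by
    intro p hp
    rw [Finset.mem_filter] at hp
    rw [plaqHol_faceSec hj V p]
    by_cases h : IsEdge p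
    · rw [if_pos (show offset p.src p.μ = P.L - 1 ∧ offset p.src p.ν = P.L - 1 from h), if_pos h]
      show (1 : ℝ) * (1 - reTr (GaugeField.plaqHol V (coarsePlaq p))) = _
      rw [hp.2]
    · rw [if_neg (show ¬ (offset p.src p.μ = P.L - 1 ∧ offset p.src p.ν = P.L - 1) from h), if_neg h,
        GaugeGroup.reTr_one, sub_self, mul_zero]
  rw [Finset.sum_congr rfl hterm, Finset.sum_ite, Finset.sum_const_zero, add_zero, Finset.sum_const, Finset.filter_filter,
    card_filter_edge hj Q, nsmul_eq_mul]
  push_cast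
  ring

end Action

/-! ## The iterated section: a right inverse of `Averaging.iter (blockAvg ℰ) k` with action `L^{(d−2)k}·A` -/

section Iter

/-- **THE ITERATED FACE SECTION** `T^{(k)} → T^{(0)}`: apply `faceSec` `k` times (independent of the small-loop average).
[cite: Balaban1987RG1, (0.11) p.253] -/
def iterSec : (k : ℕ) → GaugeField P k G → GaugeField P 0 G
  | 0 => id
  | k + 1 => fun W => iterSec k (faceSec W)

/-- `iterSec k` is a right inverse of the `k`-fold (0.4) averaging (`k ≤ m + K`, every `ℰ` with `ℰ(1,…,1) = 1`). [cite: Balaban1987RG1, (0.11) p.253] -/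
theorem iter_iterSec (ℰ : LoopAverage G) (hE : ∀ n : ℕ, ℰ.E (fun _ : Fin (n + 1) => (1 : G)) = 1) :
    ∀ k : ℕ, k ≤ P.m + P.K → ∀ W : GaugeField P k G,
      Averaging.iter (fun i => BlockAveraging.blockAvg (P := P) (j := i) ℰ) k (iterSec k W) = W
  | 0, _, _ => rfl
  | k + 1, hk, W => by
    show (BlockAveraging.blockAvg ℰ).avg (Averaging.iter (fun i => BlockAveraging.blockAvg (P := P) (j := i) ℰ) k
      (iterSec k (faceSec W))) = W
    rw [iter_iterSec ℰ hE k (by omega) (faceSec W)]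
    exact blockAvg_faceSec (by omega) ℰ hE W

/-- **ACTION OF THE ITERATED SECTION**: `A(iterSec k W) = (L^{d−2})^k · A(W)` (`k ≤ m + K`). [cite: Balaban1987RG1, (0.2) p.252] -/
theorem wilsonAction4_iterSec : ∀ k : ℕ, k ≤ P.m + P.K → ∀ W : GaugeField P k G,
    wilsonAction4 (iterSec k W) = (((P.L : ℝ)) ^ (P.d - 2)) ^ k * wilsonAction4 W
  | 0, _, W => by simp [iterSec]
  | k + 1, hk, W => by
    show wilsonAction4 (iterSec k (faceSec W)) = _
    rw [wilsonAction4_iterSec k (by omega) (faceSec W), wilsonAction4_faceSec (by omega) W, pow_succ]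
    ring

/-- The iterated section preserves `PlaqSmall δ` (`δ > 0`, `k ≤ m + K`). [cite: Balaban1987RG1, (0.18) p.255] -/
theorem plaqSmall_iterSec {δ : ℝ} (hδ : 0 < δ) : ∀ k : ℕ, k ≤ P.m + P.K → ∀ W : GaugeField P k G,
    PlaqSmall δ W → PlaqSmall δ (iterSec k W)
  | 0, _, _, hW => hW
  | k + 1, hk, W, hW => plaqSmall_iterSec hδ k (by omega) (faceSec W) (plaqSmall_faceSec (by omega) hδ hW)

end Iter

end Literature.MathematicalPhysics.QuantumFieldTheory.Balaban1983to89.BlockAveragingSectionAction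

end
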